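import Summits.Ventures.PackingBounds.SphericalCodes.TouchingMutuallyTouchingSpheresExists
import Summits.Ventures.PackingBounds.Configurations.KissingExact

/-!
# The kissing number as 'how many unit spheres can touch a unit sphere' — the `k = 0` row of the dictionary

Framing: lottery ticket; floor = certified bounds/negative ranges. Venture `PackingBounds` (cell `pub-packcert`).

The cell formalises `κ(n)` through spherical codes (`Config.kissingSizes n` = sizes of finite sets of unit vectors of `ℝⁿ`
with pairwise inner products `≤ 1/2`). The classical wording — the largest number of non-overlapping unit spheres of `ℝⁿ` that
can all touch one unit sphere (centres `c` with `‖c - a‖ = 2`, pairwise `‖c - c'‖ ≥ 2`) — is the case `K = 1` of SPLAG Ch. 14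
Theorem 1, i.e. `k = 0` in `SphericalCodes.exists_code_of_touching` / `exists_touching_of_code`. This file records the
dictionary at `k = 0` with a single centre (`kissing_touching_isGreatest`) and reads the cell's four exact kissing numbers in
that wording: **exactly `12`, `24`, `240`, `196560` unit spheres can touch a unit sphere in `ℝ³`, `ℝ⁴`, `ℝ⁸`, `ℝ²⁴`**
(`Config.kissing_dim3_eq`, `kissing_dim4_eq`, `kissing_dim8_eq`, `kissing_dim24_eq`). Mathlib-only statements.

## References
* J. H. Conway, N. J. A. Sloane, *Sphere Packings, Lattices and Groups*, 3rd ed., Springer 1999, Ch. 1 §2 and Ch. 14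
  Theorem 1. [`ConwaySloane1999`]
-/

noncomputable section

open Finset
open scoped RealInnerProductSpace

namespace Summit.Ventures.PackingBounds.SphericalCodes

/-- **Kissing configurations ↔ `1/2`-codes.** If `N` is the greatest element of `Config.kissingSizes n` (largest code of unit
vectors of `ℝⁿ` with pairwise inner products `≤ 1/2`), then `N` is the largest number of pairwise non-overlapping unit spheres of
`ℝⁿ` touching one unit sphere. [cite: ConwaySloane1999, Ch. 14 Theorem 1] -/
theorem kissing_touching_isGreatest {n N : ℕ} (h : IsGreatest (Config.kissingSizes n) N) :
    IsGreatest {M : ℕ | ∃ a : EuclideanSpace ℝ (Fin n), ∃ S : Finset (EuclideanSpace ℝ (Fin n)), S.card = M ∧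
        (∀ c ∈ S, ‖c - a‖ = 2) ∧ (∀ c ∈ S, ∀ c' ∈ S, c ≠ c' → 2 ≤ ‖c - c'‖)} N := by
  have h' : IsGreatest {M : ℕ | ∃ C : Finset (EuclideanSpace ℝ (Fin n)), C.card = M ∧ (∀ x ∈ C, ‖x‖ = 1) ∧
      (∀ x ∈ C, ∀ y ∈ C, x ≠ y → inner ℝ x y ≤ 1 / (((0 : ℕ) : ℝ) + 2))} N := by
    have e : (1 : ℝ) / (((0 : ℕ) : ℝ) + 2) = 1 / 2 := by norm_num
    refine ⟨?_, ?_⟩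
    · obtain ⟨C, hc, h1, h2⟩ := h.1
      exact ⟨C, hc, h1, fun x hx y hy hxy => (h2 x hx y hy hxy).trans_eq e.symm⟩
    · rintro M ⟨C, rfl, h1, h2⟩
      exact h.2 ⟨C, rfl, h1, fun x hx y hy hxy => (h2 x hx y hy hxy).trans_eq e⟩
  have hk := touching_isGreatest_of_code_isGreatest (n := n) (k := 0) h'
  refine ⟨?_, ?_⟩
  · obtain ⟨a, -, S, hS, hS1, hS2⟩ := hk.1
    exact ⟨a 0, S, hS, fun c hc => hS1 c hc 0, hS2⟩
  · rintro M ⟨a, S, rfl, hS1, hS2⟩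
    refine hk.2 ⟨fun _ => a, fun i j hij => absurd (Fin.ext (by have hi := i.isLt; have hj := j.isLt; omega)) hij, S,
      rfl, fun c hc _ => hS1 c hc, hS2⟩

/-- **`ℝ³`: exactly `12`** pairwise non-overlapping unit spheres can touch a unit sphere (`κ(3) = 12`, `Config.kissing_dim3_eq`:
icosahedron + the Literature proof of the thirteen-spheres theorem). [cite: ConwaySloane1999, Ch. 1 Table 1.2] -/
theorem kissing_touching_dim3 :
    IsGreatest {M : ℕ | ∃ a : EuclideanSpace ℝ (Fin 3), ∃ S : Finset (EuclideanSpace ℝ (Fin 3)), S.card = M ∧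
        (∀ c ∈ S, ‖c - a‖ = 2) ∧ (∀ c ∈ S, ∀ c' ∈ S, c ≠ c' → 2 ≤ ‖c - c'‖)} 12 :=
  kissing_touching_isGreatest Config.kissing_dim3_eq

/-- **`ℝ⁴`: exactly `24`** pairwise non-overlapping unit spheres can touch a unit sphere (`κ(4) = 24`, `Config.kissing_dim4_eq`:
`24`-cell + Musin's theorem). [cite: ConwaySloane1999, Ch. 1 Table 1.2] -/
theorem kissing_touching_dim4 :
    IsGreatest {M : ℕ | ∃ a : EuclideanSpace ℝ (Fin 4), ∃ S : Finset (EuclideanSpace ℝ (Fin 4)), S.card = M ∧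
        (∀ c ∈ S, ‖c - a‖ = 2) ∧ (∀ c ∈ S, ∀ c' ∈ S, c ≠ c' → 2 ≤ ‖c - c'‖)} 24 :=
  kissing_touching_isGreatest Config.kissing_dim4_eq

/-- **`ℝ⁸`: exactly `240`** pairwise non-overlapping unit spheres can touch a unit sphere (`κ(8) = 240`, `Config.kissing_dim8_eq`:
`E₈` roots + the kernel-checked Levenshtein/Odlyzko–Sloane LP bound). [cite: ConwaySloane1999, Ch. 1 Table 1.2] -/
theorem kissing_touching_dim8 :
    IsGreatest {M : ℕ | ∃ a : EuclideanSpace ℝ (Fin 8), ∃ S : Finset (EuclideanSpace ℝ (Fin 8)), S.card = M ∧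
        (∀ c ∈ S, ‖c - a‖ = 2) ∧ (∀ c ∈ S, ∀ c' ∈ S, c ≠ c' → 2 ≤ ‖c - c'‖)} 240 :=
  kissing_touching_isGreatest Config.kissing_dim8_eq

/-- **`ℝ²⁴`: exactly `196560`** pairwise non-overlapping unit spheres can touch a unit sphere (`κ(24) = 196560`,
`Config.kissing_dim24_eq`: Leech lattice minimal vectors + the kernel-checked LP bound). [cite: ConwaySloane1999, Ch. 1 Table 1.2] -/
theorem kissing_touching_dim24 :
    IsGreatest {M : ℕ | ∃ a : EuclideanSpace ℝ (Fin 24), ∃ S : Finset (EuclideanSpace ℝ (Fin 24)), S.card = M ∧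
        (∀ c ∈ S, ‖c - a‖ = 2) ∧ (∀ c ∈ S, ∀ c' ∈ S, c ≠ c' → 2 ≤ ‖c - c'‖)} 196560 :=
  kissing_touching_isGreatest Config.kissing_dim24_eq

end Summit.Ventures.PackingBounds.SphericalCodes
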